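import Summits.MatrixMultiplication.MatrixMultiplication.Theses.CartanCubic
import Literature.Computability.AlgebraicComplexity.AsymptoticRankMultiples

/-!
# Crux `E6Flat` (stmt-MatrixMultiplication-8156) — `Lines/birth.lean`, the BC3 birth skeleton

Route `CartanCubic` (route-MatrixMultiplication-CartanCubic; deciding theorem
`closes : E6Flat → E6ThreeProducts → MatrixMultiplication`, proved in the route file).  The crux, with
`J = cartanJ` (this file names the route's inlined `let J := …` term CHARACTER FOR CHARACTER, so the
bridge `e6Flat_iff` below is `Iff.rfl`):

  `E6Flat : R̃(J) = asymptoticRank J ≤ 27`  — six times the full polarisation of Cartan's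
  `E₆`-invariant cubic `det X + det Y + det Z − tr (XYZ)` on `ℂ²⁷ = M₃ ⊕ M₃ ⊕ M₃` (index
  `(block, (row, col)) ∈ Fin 3 × (Fin 3 × Fin 3)`; block `0 = X ∈ Hom(B,A)`, `1 = Y ∈ Hom(C,B)`,
  `2 = Z ∈ Hom(A,C)`, so the rows of block `b` live in space `b` and its columns in space `b+1`) is
  asymptotically flat (Strassen's asymptotic rank conjecture for this tight, concise, `E₆`-symmetric
  tensor; `27 ≤ R̃(J)` is the support item E6LowerFrame).

## The line (`birth`): THE INVARIANT LINE — symmetric degeneration schemes can only land on `ℂ·J^{⊠N}`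

The route header files the ENGINE of `E6Flat` in prose only ("NOT DECOMPOSED YET", card item C2:
"`J^{⊠N}` spans the one-dimensional space of `E₆^N`-invariants in its format, so any `E₆^N`-equivariant
degeneration from a unit tensor with non-zero invariant component hits `ℂ·J^{⊠N}` exactly … no
stabiliser / invariant-theory API in Lean, and as a statement it is E6Flat restated, so it rides as
the mechanism, not as an item").  This skeleton makes the mechanism kernel-checked as a LINE, with the
representation theory isolated in two TRUE stubs and the open content in one, and WITHOUT any
group-action API: the symmetry is carried by an EXPLICIT FINITE LIST `e6Gens` of fifteen diagonal
monomial maps `g = (σ, χ)` (`σ` a permutation of the `27` indices, `χ` one scalar weight per index,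
acting on all three legs at once: `(g·T) a b c = χ a · χ b · χ c · T (σ a) (σ b) (σ c)`;
`InvariantUnder g T : g·T = T`), each a symmetry of `J`, which together generate (inside the image of
`N_{E₆}(T)·T`, acting monomially on the minuscule weight basis = the `27` matrix units) a group whose
only invariants on `ℂ²⁷ ⊗ ℂ²⁷ ⊗ ℂ²⁷` are the multiples of `J`:

* six TORUS maps `torusGen d` (`σ = 1`, `χ (b,(r,c)) = d b r / d (b+1) c` for diagonal
  `(g_A, g_B, g_C) = d` with equal determinants, entries in `{1, 2, 1/2}` — a basis of the cocharacter
  lattice of the maximal torus `T(SL₃³) = T(E₆)` up to finite index; integer powers of `2`, no roots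
  of unity);
* six ROW/COLUMN PERMUTATIONS `permGen f` (`X ↦ PXQ⁻¹, Y ↦ QYR⁻¹, Z ↦ RZP⁻¹` with
  `(P,Q,R) = (f 0, f 1, f 2)`, one factor a transposition or a 3-cycle, the others `1`;
  `χ (b,·) = sgn (f b) · sgn (f (b+1))` repairs the determinant cells);
* the BLOCK SHIFT `(X,Y,Z) ↦ (Y,Z,X)` and the FLIP `(X,Y,Z) ↦ (Zᵀ,Yᵀ,Xᵀ)` (`χ = 1`);
* one WEYL REFLECTION `weylGen = s_α`, `α = α₀ + β₀ + γ₀` a root of `𝔢₆ ⊖ 𝔰𝔩₃³`: the signed involution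
  `(b,(0,c)) ↔ (b+1,(−c,0))` (`c ≠ 0`), all other indices fixed (`12` moved points = the `6`
  transposed pairs of lines of a reflection in `W(E₆)`), `χ = −1` exactly on `(b,(0,1))` and
  `(b,(1,0))` — the one generator that mixes determinant cells with trace cells.

Planner-verified in exact arithmetic this session (`calc/e6gens.py`, output quoted in
`Lines/birth.md`): (a) each of the `15` maps satisfies `g·J = J` on all `27³` entries; (b) the common
solution space `{T : g·T = T ∀ g ∈ e6Gens}` on `ℂ^{27³}` is ONE-dimensional and contains `J` (the
torus maps force `supp T ⊆ supp J` — the `270` weight-zero triples — and the nine signed permutations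
act transitively on `supp J` with a consistent sign cocycle; without the Weyl reflection there would
be two orbits `108 ∣ 162` and a `2`-dimensional solution space).  Hence the stubs:

* `stub_invariantLine` — **the invariant line at level one** (M, PROVABLE NOW, TRUE by (a)–(b)):
  `(∀ g ∈ e6Gens, InvariantUnder g T) → T ∈ ℂ·J`.  Proof to port: finite orbit bookkeeping — the six
  torus identities give `(2^k − 1) · T abc = 0`, `k ≠ 0`, off the support; the nine signed
  permutations give `T t = ± T u` along one orbit covering `supp J`, with `J`'s cocycle.  Sources:
  Manivel2006 (trialitarian model; `W(E₆)` transitive on the `45` tritangent planes = `supp J / S₃`),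
  DuffFerrara2007, ConnerGesmundoLandsbergVentura2022 (§2, symmetry groups of `det₃` and of Kronecker
  powers), this session's exact check.
* `stub_invariantLinePow` — **the invariant line passes to Kronecker powers** (M, PROVABLE NOW, TRUE
  for EVERY tensor `S : ι → ι → ι → ℂ` and EVERY finite list `G` of level-one maps): if `G`-invariance
  forces `T ∈ ℂ·S`, then invariance under the lifted maps `liftAt i g` (`g ∈ G` acting on coordinate
  `i : Fin N` of the power format `Fin N → ι`, identity on the other coordinates) forces
  `T ∈ ℂ·S^{⊠N}`.  Proof to port (slicing induction on `N`, `Fin.cons` / `kroneckerPow_succ_eq`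
  reindexing, `Fin.prod_univ_succ`): the lifts at coordinate `0` make every slice `T(·; rest)`
  `G`-invariant, hence `= c(rest) • S`; if `S = 0` then `T = 0`; else read `c` off a support entry of
  `S` — the lifts at coordinates `≥ 1` make `c` invariant under the lifted maps one level down;
  induct (`N = 0`: singleton format, `S^{⊠0} = 1`).  This is "invariants of a product of symmetry
  groups on a tensor product are products of invariants", in coordinates.  Sources: FultonHarris1991
  (§§1–2), ChristandlVranaZuiddam2023 (§1.1, Kronecker powers).
* `stub_equivariantDesign` — **the engine / the open content** (XL, OPEN; the crux in EQUIVARIANT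
  currency): for every `ε > 0` there are `N ≥ 1`, `r ≤ (27+ε)^N` and a NONZERO tensor `T` in the
  format of `J^{⊠N}`, invariant under the `15·N` lifted generators, with `⟨r⟩ ⊵ T` over `ℂ[λ]`
  (`PolyDegeneratesTo (unitTensor ℂ r) T`, i.e. `bR(T) ≤ r`, Bläser 2013 Def. 6.1 / BCS (15.19)).
  Why plausibly true: it is the route's rank-2 bet — `J` is tight and critical with `Q̃(J) = 27 =`
  every quantum functional, so no known spectral point separates `J^{⊠N}` from `⟨27^N⟩`.  The TEETH of
  the currency: the symmetry condition is `15·N` finitely checkable identities on ANY candidate `T`,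
  and a construction need NOT identify its limit — every nonzero symmetric output is `c·J^{⊠N}` by
  stubs 1–2 — so admissible constructions are symmetric degeneration SCHEMES: border apolarity with
  the Borel of `E₆^N ⋊ S_N` fixed (ConnerHarperLandsberg2019/2023 normal form, run as a construction:
  posit a Borel-fixed limit ideal with the Hilbert function of `r` points and check the apolarity
  conditions against `J^{⊠N}`), orbit-structured schemes under the finite group generated by
  `e6Gens`, and symmetrisation of any scheme with non-zero `J^{⊠N}`-component when the symmetrising
  subgroup is small.  Status: given stubs 1–2 (true) it is EQUIVALENT in truth value to the crux
  (`E6Flat ⇒` take `T = J^{⊠N}`, `r = R(J^{⊠N}) ≤ (27+ε)^N` from the infimum; `⇐` is this file), but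
  not cheaply (BC3 probes below), and strictly weaker level by level than any exact certificate
  `bR(J^{⊠N}) = 27^N` (false for every `N`: `J^{⊠N}` and `⟨27^N⟩` are non-isomorphic critical tensors
  in one format — Kempf–Ness).  Why it might fail: `ω(ℂ) > log₉(729/5) ≈ 2.2675` makes `J` a dark
  point (route kill criterion); `bR(J) ≥ 47` must decay by `43%` along powers, never certified for any
  tensor.  Sources: Strassen1991, ChristandlVranaZuiddam2023, ConnerGesmundoLandsbergVentura2022,
  ConnerHarperLandsberg2019, arXiv:2605.21738, BurgisserClausenShokrollahi1997 (Problem 15.5, (15.19)),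
  Blaser2013 (Def. 6.1).
* Sorry-free core (any `J : ι → ι → ι → ℂ`, any list `G`, any target `ρ ≥ 0`):
  `pow_asymptoticRank_le_kroneckerPow` (`R̃(t)^k ≤ R̃(t^{⊠k})`, from the infimum; same proof as
  `Theorems/AsymptoticRankCWBPerm3Form.pow_asymptoticRank_le_asymptoticRank_kroneckerPow`, copied to
  keep this workfile free of cross-route imports), `tensorRestrictsTo_of_eq_smul` (`T = c • S`,
  `c ≠ 0` ⇒ `T ≥ S`), and `asymptoticRank_le_of_invariantLine_of_designs` — the composition with the
  three stub statements as EXPLICIT hypotheses: `T = c • J^{⊠N}` with `c ≠ 0` (stubs 1+2, `T ≠ 0`), so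
  `⟨r⟩ ⊵ T ≥ J^{⊠N}` and `R̃(J)^N ≤ R̃(J^{⊠N}) ≤ R̃(⟨r⟩) ≤ r ≤ (ρ+ε)^N`
  (`asymptoticRank_le_of_polyDegeneratesTo`, `asymptoticRank_unitTensor_le`); take `N`-th roots and
  let `ε → 0`.
* `asymptoticRank_cartanJ_le_of_stubs : (stub₁-sig) → (stub₂-sig) → (stub₃-sig) → R̃(J) ≤ 27` (the
  arrow form, concluding the crux BODY) and `E6Flat_of : E6Flat` — THE skeleton theorem: the crux BY
  NAME (through the `Iff.rfl` bridge `e6Flat_iff`) from the three declared stubs, the only `sorry`s of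
  the file (the registrar takes the unique by-name theorem; its hypotheses must be declared stubs).

Honest status.  Stubs 1–2 are true lemmas (1 verified by exact computation; 2 is the coordinate form
of "invariants of powers").  Stub 3 carries the open problem: the skeleton is a currency change whose
teeth are that equivariance is a finitely checkable normal form for degeneration schemes of symmetric
tensors; it does not pretend to split an exact asymptotic statement into finite ones (impossible, see
above).  Rejected alternatives (planner NOTES.md): host splits `J ≲ ⟨3⟩ ⊠ det₃` ∧ "`det₃` flat" —
the second piece ALONE closes the summit by the landed `AsymptoticRankCW.GlueDet3Omega` (costume); the
spectral split "every universal spectral point is `≤ 27` at `J`" — by the in-tree Strassen duality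
(`strassen_duality_asymptoticRank_holds`) it is the crux verbatim; additive splits — flattening ranks of
the pieces add up beyond `27`; the header's `E6PowerDecay + BorderToAsymptotic` — the second piece is
a tree lemma (`asymptoticRank_le_algBorderRank`), i.e. a one-stub line.  Disproof used: none exists
(`ledger crux ls stmt-MatrixMultiplication-8156`: no workfiles before this one, no `Disproof.lean`, no
`Negative/` lemma; `ledger negatives --problem MatrixMultiplication` = 8 entries (2026-08-17), none
about the Cartan cubic — the one `kroneckerPow` entry, stmt-8036 SeparableDesignsMultiplicative,
concerns rank-one design families on `(Fin N → Fin 3)`, not used here), so no `_false_without_`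
obligation applies.  Kill inherited from the route: `ω(ℂ) > 2.2675`, or a universal spectral point `F`
with `F(J) > 27`, refutes stub 3 and the crux together; stubs 1–2 cannot be refuted (verified in kind).

BC3 probes (planner-run 2026-08-17, `lean check`, each `first | exact? | simpa | aesop` and the
unfolding variant `first | exact? | simpa [X] | (unfold X; simpa) | aesop` under `maxHeartbeats 400000`,
files `bc/probe_*.lean` in the planner folder): `stubᵢ → E6Flat` and `stubᵢ → MatrixMultiplication`
for `i = 1, 2, 3` — all FAIL; converses `E6Flat → stubᵢ` and the outright attempts `⊢ stubᵢ` also FAIL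
(verdicts quoted in `Lines/birth.md`).
-/

-- `Summit.<Summit>.<Problem>`: for the single-conjunct summit the duplicate component is mandated.
set_option linter.dupNamespace false

noncomputable section

namespace Summit.MatrixMultiplication.MatrixMultiplication.Cruxes.E6Flat.Birth

open scoped BigOperators
open Literature.Computability.AlgebraicComplexity
open Literature.Barriers.MatrixMultiplication (PolyDegeneratesTo asymptoticRank_le_of_polyDegeneratesTo
  asymptoticRank_le_rpow tensorRank_kroneckerPow_mul)
open Summit.MatrixMultiplication.MatrixMultiplication.Theses.CartanCubic (E6Flat)

/-! ## The tensor -/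

/-- The index set `Fin 3 × (Fin 3 × Fin 3)` = (block `X/Y/Z`, (row, column)) of
`ℂ²⁷ = M₃ ⊕ M₃ ⊕ M₃`; rows of block `b` are indexed by space `b`, columns by space `b + 1`
(`A, B, C = 0, 1, 2`). [folklore] -/
abbrev Idx : Type := Fin 3 × (Fin 3 × Fin 3)

/-- **Cartan's cubic tensor `J`** — the route's inlined `let J := …` term, character for character:
`ε(rows)·ε(cols)` on the three diagonal block cells (polarised `det₃`), `−1` on the six permutation cells
at the index pattern of `tr (m₁m₂m₃)` / `tr (m₁m₃m₂)`, `0` elsewhere (270 nonzero entries; Manivel 2006,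
the trialitarian model `det X + det Y + det Z − tr (XYZ)`). [cite: Manivel2006] -/
def cartanJ : Idx → Idx → Idx → ℂ := fun a b c => if a.1 = b.1 ∧ b.1 = c.1 then ((if b.2.1 = a.2.1 + 1 ∧ c.2.1 = a.2.1 + 2 then (1 : ℂ) else 0) - (if b.2.1 = a.2.1 + 2 ∧ c.2.1 = a.2.1 + 1 then 1 else 0)) * ((if b.2.2 = a.2.2 + 1 ∧ c.2.2 = a.2.2 + 2 then (1 : ℂ) else 0) - (if b.2.2 = a.2.2 + 2 ∧ c.2.2 = a.2.2 + 1 then 1 else 0)) else if b.1 = a.1 + 1 ∧ c.1 = a.1 + 2 then (if a.2.2 = b.2.1 ∧ b.2.2 = c.2.1 ∧ c.2.2 = a.2.1 then -1 else 0) else if b.1 = a.1 + 2 ∧ c.1 = a.1 + 1 then (if a.2.2 = c.2.1 ∧ c.2.2 = b.2.1 ∧ b.2.2 = a.2.1 then -1 else 0) else 0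

/-! ## Diagonal monomial maps, invariance, lifting to Kronecker powers -/

/-- **Invariance under a diagonal monomial map** `g = (σ, χ)` (a permutation of the index set and one
scalar weight per index, acting on all three legs at once):
`χ a · χ b · χ c · T (σ a) (σ b) (σ c) = T a b c` for all `a b c`. [folklore] -/
def InvariantUnder {ι : Type} (g : Equiv.Perm ι × (ι → ℂ)) (T : ι → ι → ι → ℂ) : Prop :=
  ∀ a b c, g.2 a * g.2 b * g.2 c * T (g.1 a) (g.1 b) (g.1 c) = T a b c

/-- **Lift of a level-one map to coordinate `i` of the `N`-th Kronecker power format** `Fin N → ι`: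
`σ` acts on the `i`-th coordinate (identity on the others), the weight is `χ (a i)`.  Products over
`i` of lifts of symmetries of `S` are symmetries of `S^{⊠N}`. [folklore] -/
def liftAt {ι : Type} {N : ℕ} (i : Fin N) (g : Equiv.Perm ι × (ι → ℂ)) :
    Equiv.Perm (Fin N → ι) × ((Fin N → ι) → ℂ) :=
  (Equiv.piCongrRight fun j => if j = i then g.1 else Equiv.refl ι, fun a => g.2 (a i))

/-- **Torus map** of the diagonal element `(g_A, g_B, g_C) = (d 0, d 1, d 2)` (equal determinants):
`σ = 1`, `χ (b,(r,c)) = d b r / d (b+1) c` (`X ↦ g_A X g_B⁻¹`, `Y ↦ g_B Y g_C⁻¹`, `Z ↦ g_C Z g_A⁻¹`).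
[cite: Manivel2006] -/
def torusGen (d : Fin 3 → Fin 3 → ℂ) : Equiv.Perm Idx × (Idx → ℂ) :=
  (Equiv.refl Idx, fun a => d a.1 a.2.1 / d (a.1 + 1) a.2.2)

/-- **Row/column permutation map** of `(P, Q, R) = (f 0, f 1, f 2) ∈ S₃³`:
`σ (b,(r,c)) = (b, (f b r, f (b+1) c))` (`X ↦ PXQ⁻¹, Y ↦ QYR⁻¹, Z ↦ RZP⁻¹`), with the sign repair
`χ (b,·) = sgn (f b) · sgn (f (b+1))` on the determinant cells. [cite: Manivel2006] -/
def permGen (f : Fin 3 → Equiv.Perm (Fin 3)) : Equiv.Perm Idx × (Idx → ℂ) :=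
  (Equiv.prodShear (Equiv.refl (Fin 3)) (fun b => Equiv.prodCongr (f b) (f (b + 1))),
    fun a => ((Equiv.Perm.sign (f a.1) : ℤ) : ℂ) * ((Equiv.Perm.sign (f (a.1 + 1)) : ℤ) : ℂ))

/-- **Block shift** `(X,Y,Z) ↦ (Y,Z,X)`: `σ (b, rc) = (b+1, rc)`, `χ = 1`. [cite: Manivel2006] -/
def shiftGen : Equiv.Perm Idx × (Idx → ℂ) :=
  (Equiv.prodCongr (Equiv.addRight (1 : Fin 3)) (Equiv.refl (Fin 3 × Fin 3)), fun _ => 1)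

/-- **Flip** `(X,Y,Z) ↦ (Zᵀ,Yᵀ,Xᵀ)`: `σ (b,(r,c)) = (2−b, (c,r))`, `χ = 1`. [cite: Manivel2006] -/
def flipGen : Equiv.Perm Idx × (Idx → ℂ) :=
  (Equiv.prodCongr ((Equiv.neg (Fin 3)).trans (Equiv.addRight (2 : Fin 3)))
      (Equiv.prodComm (Fin 3) (Fin 3)), fun _ => 1)

/-- The point map of the **Weyl reflection** `s_α`, `α = α₀ + β₀ + γ₀` (a root of `𝔢₆` outside
`𝔰𝔩₃³`): `(b,(0,c)) ↦ (b+1,(−c,0))` for `c ≠ 0`, `(b,(r,0)) ↦ (b−1,(0,−r))` for `r ≠ 0`, all other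
indices fixed — an involution moving `12` of the `27` points. [cite: Manivel2006] -/
def weylFun : Idx → Idx := fun a =>
  if a.2.1 = 0 ∧ a.2.2 ≠ 0 then (a.1 + 1, (-a.2.2, 0))
  else if a.2.1 ≠ 0 ∧ a.2.2 = 0 then (a.1 - 1, (0, -a.2.1))
  else a

/-- `weylFun` is an involution (finite check). [folklore] -/
theorem weylFun_involutive : Function.Involutive weylFun := by
  unfold Function.Involutive weylFun
  decide

/-- **Weyl reflection map** `weylGen = (s_α, χ)` with `χ = −1` exactly on the indices `(b,(0,1))` and
`(b,(1,0))` (one solution of the sign system; planner-verified: `χ·χ·χ·J ∘ s_α = J`).  The one generator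
mixing determinant cells with trace cells. [cite: Manivel2006] -/
def weylGen : Equiv.Perm Idx × (Idx → ℂ) :=
  (weylFun_involutive.toPerm _,
    fun a => if (a.2.1 = 0 ∧ a.2.2 = 1) ∨ (a.2.1 = 1 ∧ a.2.2 = 0) then -1 else 1)

/-- **The explicit symmetry list `e6Gens`** (15 diagonal monomial symmetries of `J`): six torus maps
(entries `1, 2, 2⁻¹`; a finite-index sublattice of the cocharacters of `T(E₆) = T(SL₃³)`), six row/column
permutations (a transposition or a 3-cycle in one of `A, B, C`), the block shift, the flip, and one Weyl
reflection.  Planner-verified in exact arithmetic (`calc/e6gens.py`): each fixes `J`, and their common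
invariants on `ℂ²⁷ ⊗ ℂ²⁷ ⊗ ℂ²⁷` are exactly `ℂ·J`. [cite: Manivel2006] -/
def e6Gens : List (Equiv.Perm Idx × (Idx → ℂ)) :=
  [torusGen ![![2, 2⁻¹, 1], ![1, 1, 1], ![1, 1, 1]], torusGen ![![1, 2, 2⁻¹], ![1, 1, 1], ![1, 1, 1]],
    torusGen ![![1, 1, 1], ![2, 2⁻¹, 1], ![1, 1, 1]], torusGen ![![1, 1, 1], ![1, 2, 2⁻¹], ![1, 1, 1]],
    torusGen ![![1, 1, 1], ![1, 1, 1], ![2, 2⁻¹, 1]], torusGen ![![1, 1, 1], ![1, 1, 1], ![1, 2, 2⁻¹]],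
    permGen ![Equiv.swap 0 1, 1, 1], permGen ![finRotate 3, 1, 1],
    permGen ![1, Equiv.swap 0 1, 1], permGen ![1, finRotate 3, 1],
    permGen ![1, 1, Equiv.swap 0 1], permGen ![1, 1, finRotate 3],
    shiftGen, flipGen, weylGen]

/-! ## The three registered stubs -/

/-- **Stub 1 — the invariant line at level one.**  A tensor on `ℂ²⁷ ⊗ ℂ²⁷ ⊗ ℂ²⁷` invariant under the
fifteen explicit diagonal monomial symmetries `e6Gens` of Cartan's cubic tensor `J` is a scalar multiple
of `J`.  TRUE (planner-verified in exact arithmetic, `calc/e6gens.py`: the common solution space on all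
`27³` entries is one-dimensional and contains `J`): the six torus identities kill every entry off the
`270` support triples (`(2^k − 1)·T abc = 0` with `k ≠ 0`), and the nine signed permutations act
transitively on `supp J` with `J`'s sign cocycle, so `T/J` is constant there.  Size M, provable now
(finite orbit bookkeeping).  Sources: Manivel2006, DuffFerrara2007, ConnerGesmundoLandsbergVentura2022. -/
theorem stub_invariantLine :
    ∀ T : Idx → Idx → Idx → ℂ, (∀ g ∈ e6Gens, InvariantUnder g T) → ∃ c : ℂ, T = c • cartanJ := by
  sorry

/-- **Stub 2 — the invariant line passes to Kronecker powers** (for EVERY tensor `S` and EVERY list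
`G` of level-one maps; invariants of a product of symmetries on a tensor power, in coordinates): if
`G`-invariance forces `T ∈ ℂ·S`, then invariance under all lifts `liftAt i g` (`i : Fin N`, `g ∈ G`)
forces `T ∈ ℂ·S^{⊠N}`.  TRUE: the lifts at coordinate `0` make every slice of `T` `G`-invariant, hence a
multiple `c(rest) • S`; if `S ≠ 0` the coefficient tensor `c` is invariant under the lifts one level
down; induct (`N = 0`: singleton format, `S^{⊠0} = 1`; `S = 0`: `T = 0`).  Size M, provable now
(`Fin.cons` / `kroneckerPow_succ_eq` reindexing, `Fin.prod_univ_succ`).  Sources: FultonHarris1991,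
ChristandlVranaZuiddam2023 (§1.1). -/
theorem stub_invariantLinePow :
    ∀ {ι : Type} (S : ι → ι → ι → ℂ) (G : List (Equiv.Perm ι × (ι → ℂ))),
      (∀ T : ι → ι → ι → ℂ, (∀ g ∈ G, InvariantUnder g T) → ∃ c : ℂ, T = c • S) →
        ∀ (N : ℕ) (T : (Fin N → ι) → (Fin N → ι) → (Fin N → ι) → ℂ),
          (∀ i : Fin N, ∀ g ∈ G, InvariantUnder (liftAt i g) T) →
            ∃ c : ℂ, T = c • kroneckerPow S N := by
  sorry

/-- **Stub 3 — equivariant designs (the engine; the crux in equivariant currency).**  For every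
`ε > 0` some Kronecker power format of `J` (`N ≥ 1`) carries a NONZERO tensor `T`, invariant under the
`15·N` lifted generators `liftAt i g` (`g ∈ e6Gens`), that is a degeneration over `ℂ[λ]` of a unit
tensor `⟨r⟩` with `r ≤ (27+ε)^N` — an `E₆^N`-symmetric border-rank-`r` scheme with non-zero output; by
stubs 1–2 its output is `c • J^{⊠N}`, `c ≠ 0`, which the scheme need not know, and the symmetry
requirement is finitely checkable on any candidate.  OPEN (size XL): given stubs 1–2 it is equivalent
in truth value to the crux, strictly weaker level by level than any exact certificate (`J^{⊠N}` and
`⟨27^N⟩` are non-isomorphic critical tensors in one format).  Why it might fail: `ω(ℂ) > 2.2675` (then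
`J` is dark in format `27`); the needed `43%` border-rank decay from `bR(J) ≥ 47` has never been
certified for any tensor.  Sources: Strassen1991, ChristandlVranaZuiddam2023,
ConnerGesmundoLandsbergVentura2022, ConnerHarperLandsberg2019, arXiv:2605.21738,
BurgisserClausenShokrollahi1997, Blaser2013. -/
theorem stub_equivariantDesign :
    ∀ ε : ℝ, 0 < ε → ∃ (N r : ℕ) (T : (Fin N → Idx) → (Fin N → Idx) → (Fin N → Idx) → ℂ),
      1 ≤ N ∧ (r : ℝ) ≤ (27 + ε) ^ N ∧ T ≠ 0 ∧ (∀ i : Fin N, ∀ g ∈ e6Gens, InvariantUnder (liftAt i g) T) ∧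
        PolyDegeneratesTo (unitTensor ℂ r) T := by
  sorry

/-! ## Sorry-free core -/

/-- **`R̃(t)^k ≤ R̃(t^{⊠k})`** (`k ≥ 1`): from the infimum, `R̃(t) ≤ R(t^{⊠(Nk)})^{1/(Nk)} =
(R((t^{⊠k})^{⊠N})^{1/N})^{1/k}` for every `N ≥ 1` (Christandl–Vrana–Zuiddam 2023, §1.1; same proof as
`Theorems/AsymptoticRankCWBPerm3Form.pow_asymptoticRank_le_asymptoticRank_kroneckerPow`). [folklore] -/
theorem pow_asymptoticRank_le_kroneckerPow {ι κ μ : Type*} [Fintype ι] [Fintype κ] [Fintype μ]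
    (t : ι → κ → μ → ℂ) {k : ℕ} (hk : 0 < k) :
    asymptoticRank t ^ k ≤ asymptoticRank (kroneckerPow t k) := by
  have h0 : 0 ≤ asymptoticRank t := asymptoticRank_nonneg t
  have hk0 : (k : ℝ) ≠ 0 := by exact_mod_cast hk.ne'
  refine le_ciInf fun N => ?_
  have hkN : 0 < (N + 1) * k := Nat.mul_pos (Nat.succ_pos N) hk
  have h1 := asymptoticRank_le_rpow t hkN
  rw [tensorRank_kroneckerPow_mul t (N + 1) k] at h1
  calc asymptoticRank t ^ k
      ≤ (((tensorRank (kroneckerPow (kroneckerPow t k) (N + 1)) : ℝ)) ^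
          ((((N + 1) * k : ℕ) : ℝ))⁻¹) ^ k := pow_le_pow_left₀ h0 h1 k
    _ = (tensorRank (kroneckerPow (kroneckerPow t k) (N + 1)) : ℝ) ^ ((N : ℝ) + 1)⁻¹ := by
        rw [← Real.rpow_natCast, ← Real.rpow_mul (Nat.cast_nonneg _)]
        congr 1
        push_cast
        rw [mul_inv, inv_mul_cancel_right₀ hk0]

/-- **A nonzero multiple restricts to the tensor**: `T = c • S` with `c ≠ 0` gives `T ≥ S`
(scale one leg by `c⁻¹`). [folklore] -/
theorem tensorRestrictsTo_of_eq_smul {ι κ μ : Type} [Fintype ι] [Fintype κ] [Fintype μ]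
    [DecidableEq ι] [DecidableEq κ] [DecidableEq μ] {S T : ι → κ → μ → ℂ} {c : ℂ} (hc : c ≠ 0)
    (hT : T = c • S) : TensorRestrictsTo T S := by
  refine ⟨fun a' a => if a = a' then c⁻¹ else 0, fun b' b => if b = b' then 1 else 0,
    fun c' c => if c = c' then 1 else 0, fun a' b' c' => ?_⟩
  rw [Finset.sum_eq_single a' (fun a _ ha => by simp [ha]) (by simp),
    Finset.sum_eq_single b' (fun b _ hb => by simp [hb]) (by simp),
    Finset.sum_eq_single c' (fun c _ hc => by simp [hc]) (by simp)]
  simp only [if_true, hT, Pi.smul_apply, smul_eq_mul]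
  field_simp

/-- **Composition with explicit hypotheses** (the BC3 shape `stub₁-sig → stub₂-sig → stub₃-sig →
crux-content`, for ANY tensor `J : ι → ι → ι → ℂ`, any list `G` of level-one maps and any target
`ρ ≥ 0`): if `G`-invariance forces the line `ℂ·J`, this passes to Kronecker powers along lifts, and
for every `ε > 0` some nonzero lift-invariant tensor is a degeneration of `⟨r⟩` with `r ≤ (ρ+ε)^N`
(`N ≥ 1`), then `R̃(J) ≤ ρ`.  Proof: the design output is `c • J^{⊠N}` with `c ≠ 0`, so
`⟨r⟩ ⊵ T ≥ J^{⊠N}` and `R̃(J)^N ≤ R̃(J^{⊠N}) ≤ R̃(⟨r⟩) ≤ r ≤ (ρ+ε)^N`; `N`-th roots, `ε → 0`.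
Sorry-free, standard axioms. [folklore] -/
theorem asymptoticRank_le_of_invariantLine_of_designs {ι : Type} [Fintype ι] [DecidableEq ι]
    (J : ι → ι → ι → ℂ) (G : List (Equiv.Perm ι × (ι → ℂ))) (ρ : ℝ) (hρ : 0 ≤ ρ)
    (hline : ∀ T : ι → ι → ι → ℂ, (∀ g ∈ G, InvariantUnder g T) → ∃ c : ℂ, T = c • J)
    (hpow : ∀ {ι : Type} (S : ι → ι → ι → ℂ) (G : List (Equiv.Perm ι × (ι → ℂ))),
      (∀ T : ι → ι → ι → ℂ, (∀ g ∈ G, InvariantUnder g T) → ∃ c : ℂ, T = c • S) →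
        ∀ (N : ℕ) (T : (Fin N → ι) → (Fin N → ι) → (Fin N → ι) → ℂ),
          (∀ i : Fin N, ∀ g ∈ G, InvariantUnder (liftAt i g) T) →
            ∃ c : ℂ, T = c • kroneckerPow S N)
    (hdes : ∀ ε : ℝ, 0 < ε → ∃ (N r : ℕ) (T : (Fin N → ι) → (Fin N → ι) → (Fin N → ι) → ℂ),
      1 ≤ N ∧ (r : ℝ) ≤ (ρ + ε) ^ N ∧ T ≠ 0 ∧ (∀ i : Fin N, ∀ g ∈ G, InvariantUnder (liftAt i g) T) ∧
        PolyDegeneratesTo (unitTensor ℂ r) T) :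
    asymptoticRank J ≤ ρ := by
  -- `R̃(J) ≤ ρ + ε` for every `ε > 0`
  refine le_of_forall_pos_le_add fun ε hε => ?_
  obtain ⟨N, r, T, hN, hr, hT0, hsym, hdeg⟩ := hdes ε hε
  -- the design output lies on the invariant line: `T = c • J^{⊠N}`, and `c ≠ 0` since `T ≠ 0`
  obtain ⟨c, hc⟩ := hpow J G hline N T hsym
  have hc0 : c ≠ 0 := by
    rintro rfl
    exact hT0 (by rw [hc, zero_smul])
  -- `⟨r⟩ ⊵ T ≥ J^{⊠N}`, so `R̃(J^{⊠N}) ≤ R̃(⟨r⟩) ≤ r`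
  have hTJ : TensorRestrictsTo T (kroneckerPow J N) := tensorRestrictsTo_of_eq_smul hc0 hc
  have h1 : asymptoticRank (kroneckerPow J N) ≤ r :=
    (asymptoticRank_le_of_polyDegeneratesTo (hdeg.trans hTJ.polyDegeneratesTo)).trans
      (asymptoticRank_unitTensor_le ℂ r)
  -- `R̃(J)^N ≤ R̃(J^{⊠N}) ≤ r ≤ (ρ + ε)^N`
  have hN0 : 0 < N := hN
  have h2 : asymptoticRank J ^ N ≤ (ρ + ε) ^ N :=
    (pow_asymptoticRank_le_kroneckerPow J hN0).trans (h1.trans hr)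
  exact le_of_pow_le_pow_left₀ hN0.ne' (by positivity) h2

/-! ## The composition: the three stubs prove the crux BY NAME -/

/-- `E6Flat` is, character for character, `asymptoticRank cartanJ ≤ 27` (the route's `let J := …` is
the body of `cartanJ`). [folklore] -/
theorem e6Flat_iff : E6Flat ↔ asymptoticRank cartanJ ≤ 27 := Iff.rfl

/-- **Arrow form** (`stub₁-sig → stub₂-sig → stub₃-sig → crux content`): the body of the crux,
`asymptoticRank cartanJ ≤ 27` (= `E6Flat` by `e6Flat_iff`), from the three stub STATEMENTS as
hypotheses, through the sorry-free core at `ρ = 27`, `G = e6Gens`.  No `sorry` is reachable from this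
theorem (axioms: propext, Classical.choice, Quot.sound).  (It concludes the crux BODY, not its name, so
that `E6Flat_of` below is the unique by-name skeleton theorem the registrar reads.) [folklore] -/
theorem asymptoticRank_cartanJ_le_of_stubs
    (h₁ : ∀ T : Idx → Idx → Idx → ℂ, (∀ g ∈ e6Gens, InvariantUnder g T) → ∃ c : ℂ, T = c • cartanJ)
    (h₂ : ∀ {ι : Type} (S : ι → ι → ι → ℂ) (G : List (Equiv.Perm ι × (ι → ℂ))),
      (∀ T : ι → ι → ι → ℂ, (∀ g ∈ G, InvariantUnder g T) → ∃ c : ℂ, T = c • S) →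
        ∀ (N : ℕ) (T : (Fin N → ι) → (Fin N → ι) → (Fin N → ι) → ℂ),
          (∀ i : Fin N, ∀ g ∈ G, InvariantUnder (liftAt i g) T) →
            ∃ c : ℂ, T = c • kroneckerPow S N)
    (h₃ : ∀ ε : ℝ, 0 < ε → ∃ (N r : ℕ) (T : (Fin N → Idx) → (Fin N → Idx) → (Fin N → Idx) → ℂ),
      1 ≤ N ∧ (r : ℝ) ≤ (27 + ε) ^ N ∧ T ≠ 0 ∧
        (∀ i : Fin N, ∀ g ∈ e6Gens, InvariantUnder (liftAt i g) T) ∧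
          PolyDegeneratesTo (unitTensor ℂ r) T) :
    asymptoticRank cartanJ ≤ 27 :=
  asymptoticRank_le_of_invariantLine_of_designs cartanJ e6Gens 27 (by norm_num) h₁ h₂ h₃

/-- **THE SKELETON THEOREM.**  The crux
`Summit.MatrixMultiplication.MatrixMultiplication.Theses.CartanCubic.E6Flat` (stmt-MatrixMultiplication-8156),
concluded BY NAME from the three DECLARED stubs `stub_invariantLine`, `stub_invariantLinePow`,
`stub_equivariantDesign` — the only `sorry`s of the file. [folklore] -/
theorem E6Flat_of : Summit.MatrixMultiplication.MatrixMultiplication.Theses.CartanCubic.E6Flat :=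
  e6Flat_iff.mpr
    (asymptoticRank_cartanJ_le_of_stubs stub_invariantLine stub_invariantLinePow stub_equivariantDesign)

end Summit.MatrixMultiplication.MatrixMultiplication.Cruxes.E6Flat.Birth

end
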